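import Mathlib
import Literature.AlgebraicGeometry.Resolution.ResolutionOfSingularities
import Literature.AlgebraicGeometry.Resolution.ResolutionGlue
import Summits.ResolutionOfSingularities.ResolutionOfSingularities.Theorems.FrobeniusLadderFRationalResolutionResolutionOpenGlue
import HarnessLib

/-!
# Symmetric open gluing of two resolutions (crux `FrobeniusLadder.FRationalResolution`, line `Sketch`)

Stub `stub_hasResolution_glue2` of the skeleton `Sketch` for crux stmt-ResolutionOfSingularities-15317:
the induction step of "resolution is Zariski-local" (theme L). A scheme `X` is covered by the ranges
of two open immersions `iA : A → X`, `iB : B → X`; `W ⊆ X` is an open containing `iA(A) ∩ iB(B)`;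
`α : A' → A` and `β : B' → B` are proper morphisms from regular schemes which are isomorphisms over
`iA⁻¹ W`, `iB⁻¹ W`, with dense preimages of these opens. Then `X` receives a proper morphism
`π : X' → X` from a regular scheme which is an isomorphism over `W`, with dense preimage of `W`.
This generalises the asymmetric `stub_hasResolution_glue` (`…ResolutionOpenGlue.lean`), whose
push-out lemmas `openGlue_*` are reused.

Construction: `O := iA(A) ∩ iB(B)` (an open subscheme of `X`, `O ⊆ W`). Since `α` is an
isomorphism over `iA⁻¹ W ⊇ iA⁻¹ O`, the inclusion `O ⊆ X` lifts uniquely to an open immersion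
`b : O → A'` with `b ≫ α ≫ iA = O.ι` (`exists_openGlue_leg`), and symmetrically `a : O → B'`.
`X' := A' ⨿_O B'` is the push-out of the open immersions `b`, `a` (Mathlib: colimit of a locally
directed diagram of open immersions; the legs are open immersions and jointly surjective), and
`π := pushout.desc (α ≫ iA) (β ≫ iB)`. Pointwise bookkeeping gives `π⁻¹(iA(A)) = inl(A')` and
`π⁻¹(iB(B)) = inr(B')`, whence the cartesian squares `IsPullback α inl iA π`, `IsPullback β inr iB π`
(`IsOpenImmersion.isPullback`). So `π` is `α` over `iA(A)` and `β` over `iB(B)`: proper (properness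
is Zariski-local on the target); pasting with the restriction squares, `π` is `α ∣_ iA⁻¹W` over
`iA(A) ∩ W` and `β ∣_ iB⁻¹W` over `iB(B) ∩ W`, hence an isomorphism over their union `W`
(`isIso_morphismRestrict_sup`). `X'` is regular (stalks of `A'` or of `B'`), and `π⁻¹ W` is dense
since its traces on the open pieces `inl(A') ≅ A'`, `inr(B') ≅ B'` are the dense opens
`α⁻¹ iA⁻¹ W`, `β⁻¹ iB⁻¹ W`.
-/

set_option linter.dupNamespace false

noncomputable section

open CategoryTheory CategoryTheory.Limits AlgebraicGeometry TopologicalSpace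
  Literature.AlgebraicGeometry.Resolution

universe u

namespace Summit.ResolutionOfSingularities.ResolutionOfSingularities.Theorems.FRationalResolution

/-- If `IsPullback ρ j i π` with `i : V → X` an open immersion, then `π ∣_ i(V)` is `ρ` up to
isomorphism of arrows, so every isomorphism-invariant property passes from `ρ` to `π ∣_ i(V)`
(variant of `openGlue_morphismRestrict_opensRange` taking the cartesian square as input). -/
theorem morphismRestrict_opensRange_of_isPullback {X' X Y V : Scheme.{u}} (π : X' ⟶ X)
    (j : Y ⟶ X') (ρ : Y ⟶ V) (i : V ⟶ X) [IsOpenImmersion i] (sq : IsPullback ρ j i π)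
    (P : MorphismProperty Scheme.{u}) [P.RespectsIso] (hρ : P ρ) : P (π ∣_ i.opensRange) := by
  have h1 : P (pullback.snd π i) := by
    rw [← sq.flip.isoPullback_inv_snd]
    exact (P.cancel_left_of_respectsIso _ _).mpr hρ
  exact (P.arrow_mk_iso_iff (morphismRestrictOpensRange π i)).mpr h1

/-- Restricting a cartesian square over the range of an open immersion `iA : A → X` to an open
`W ⊆ X`: if `IsPullback α inl iA π` and `α` is an isomorphism over `iA⁻¹ W`, then `π` is an
isomorphism over `iA(A) ∩ W` (paste with the restriction square of `α` over `iA⁻¹ W`, whose bottom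
edge `iA⁻¹ W ⊆ A → X` is an open immersion with range `iA(A) ∩ W`). -/
theorem isIso_morphismRestrict_inf_of_isPullback {A' A X' X : Scheme.{u}} (α : A' ⟶ A)
    (inl : A' ⟶ X') (iA : A ⟶ X) [IsOpenImmersion iA] (π : X' ⟶ X)
    (sq : IsPullback α inl iA π) (W : X.Opens) (hα : IsIso (α ∣_ (iA ⁻¹ᵁ W))) :
    IsIso (π ∣_ (iA.opensRange ⊓ W)) := by
  have sq' : IsPullback (α ∣_ (iA ⁻¹ᵁ W)) ((α ⁻¹ᵁ (iA ⁻¹ᵁ W)).ι ≫ inl) ((iA ⁻¹ᵁ W).ι ≫ iA) π :=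
    ((isPullback_morphismRestrict α (iA ⁻¹ᵁ W)).flip.paste_horiz sq.flip).flip
  have h := morphismRestrict_opensRange_of_isPullback π _ _ _ sq'
    (MorphismProperty.isomorphisms Scheme.{u}) hα
  have e : ((iA ⁻¹ᵁ W).ι ≫ iA).opensRange = iA.opensRange ⊓ W := by
    rw [Scheme.Hom.opensRange_comp, Scheme.Opens.opensRange_ι,
      Scheme.Hom.image_preimage_eq_opensRange_inf]
  rw [e] at h
  exact h

/-- The leg of the gluing over one piece. Let `iA : A → X` be an open immersion, `W ⊆ X` an open,
`α : A' → A` an isomorphism over `iA⁻¹ W`, and `j : Wt → X` an open immersion with range inside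
`iA(A) ∩ W`. Then `j` lifts to an open immersion `b : Wt → A'` with `b ≫ α ≫ iA = j` (lift `j`
along the open immersion `α⁻¹ iA⁻¹ W ≅ iA⁻¹ W ⊆ A → X`), and every point of `A'` lying over the range
of `j` is in the range of `b` (injectivity of `α` on `α⁻¹ iA⁻¹ W`). -/
theorem exists_openGlue_leg {A' A X Wt : Scheme.{u}} (α : A' ⟶ A) (iA : A ⟶ X)
    [IsOpenImmersion iA] (W : X.Opens) (hα : IsIso (α ∣_ (iA ⁻¹ᵁ W))) (j : Wt ⟶ X)
    [IsOpenImmersion j] (hjA : j.opensRange ≤ iA.opensRange) (hjW : j.opensRange ≤ W) :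
    ∃ b : Wt ⟶ A', IsOpenImmersion b ∧ b ≫ α ≫ iA = j ∧
      ∀ u : A', iA (α u) ∈ j.opensRange → u ∈ Set.range b := by
  set WA : A.Opens := iA ⁻¹ᵁ W with hWA
  -- the open immersion `α⁻¹(WA) ≅ WA ⊆ A → X`
  obtain ⟨f, hf⟩ : ∃ f : (↑(α ⁻¹ᵁ WA) : Scheme.{u}) ⟶ X, f = (α ⁻¹ᵁ WA).ι ≫ α ≫ iA := ⟨_, rfl⟩
  have hf' : f = (α ∣_ WA) ≫ WA.ι ≫ iA := by
    rw [hf, ← morphismRestrict_ι_assoc]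
  haveI : IsOpenImmersion f := by
    rw [hf']
    infer_instance
  -- the range of `j` is contained in the range of `f`
  have hrange : Set.range j ⊆ Set.range f := by
    rintro _ ⟨w, rfl⟩
    have hwA : j w ∈ iA.opensRange := hjA ⟨w, rfl⟩
    obtain ⟨s, hs⟩ := hwA
    have hsW : s ∈ WA := by
      show iA s ∈ W
      rw [hs]
      exact hjW ⟨w, rfl⟩
    obtain ⟨t, ht⟩ := (inferInstance : Surjective (α ∣_ WA)).1 ⟨s, hsW⟩
    refine ⟨t, ?_⟩
    rw [hf', Scheme.Hom.comp_apply, Scheme.Hom.comp_apply, ht, Scheme.Opens.ι_apply]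
    exact hs
  -- the lift
  obtain ⟨b, hb_def⟩ : ∃ b : Wt ⟶ A', b = IsOpenImmersion.lift f j hrange ≫ (α ⁻¹ᵁ WA).ι :=
    ⟨_, rfl⟩
  have hbo : IsOpenImmersion b := by
    haveI : IsOpenImmersion (IsOpenImmersion.lift f j hrange) := by
      haveI : IsOpenImmersion (IsOpenImmersion.lift f j hrange ≫ f) := by
        rw [IsOpenImmersion.lift_fac]
        infer_instance
      exact IsOpenImmersion.of_comp _ f
    rw [hb_def]
    infer_instance
  have hb : b ≫ α ≫ iA = j := by
    rw [hb_def, Category.assoc, ← hf, IsOpenImmersion.lift_fac]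
  refine ⟨b, hbo, hb, fun u hu => ?_⟩
  obtain ⟨w, hw⟩ := hu
  have h1 : (b ≫ α ≫ iA) w = iA (α u) := by
    rw [hb]
    exact hw
  rw [Scheme.Hom.comp_apply, Scheme.Hom.comp_apply] at h1
  have h2 : α (b w) = α u := iA.isOpenEmbedding.injective h1
  have huW : α u ∈ WA := by
    show iA (α u) ∈ W
    rw [← hw]
    exact hjW ⟨w, rfl⟩
  have hbW : α (b w) ∈ WA := by
    rw [h2]
    exact huW
  have h3 : (⟨b w, hbW⟩ : α ⁻¹ᵁ WA) = ⟨u, huW⟩ := by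
    apply (α ∣_ WA).isOpenEmbedding.injective
    apply Subtype.ext
    rw [morphismRestrict_base_coe, morphismRestrict_base_coe]
    exact h2
  exact ⟨w, congrArg Subtype.val h3⟩

section Pushout

variable {Wt U Y : Scheme.{u}} (b : Wt ⟶ U) (a : Wt ⟶ Y) [IsOpenImmersion b] [IsOpenImmersion a]

/-- A subset of the push-out `U ⨿_W Y` of two open immersions whose traces on `U` and on `Y` are
dense is dense (the legs are jointly surjective). -/
theorem openGlue_dense (S : Set ↥(pushout b a)) (hU : Dense ((pushout.inl b a) ⁻¹' S))
    (hY : Dense ((pushout.inr b a) ⁻¹' S)) : Dense S := by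
  intro z
  rcases openGlue_point_cases b a z with ⟨u, rfl⟩ | ⟨y, rfl⟩
  · exact closure_mono (Set.image_preimage_subset _ S)
      (image_closure_subset_closure_image (pushout.inl b a).continuous ⟨u, hU u, rfl⟩)
  · exact closure_mono (Set.image_preimage_subset _ S)
      (image_closure_subset_closure_image (pushout.inr b a).continuous ⟨y, hY y, rfl⟩)

end Pushout

/-- SYMMETRIC OPEN GLUING OF TWO RESOLUTIONS. `X` covered by the ranges of two open immersions
`iA : A → X`, `iB : B → X`; `W ⊆ X` an open containing `A ∩ B`; `α : A' → A` and `β : B' → B`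
proper morphisms from regular schemes which are isomorphisms over `iA⁻¹ W` resp. `iB⁻¹ W` with
dense preimages of these. Then `X` receives a proper `π : X' → X` from a regular scheme, an
isomorphism over `W` with dense preimage of `W`: `X' = A' ⨿_{A ∩ B} B'`, glued along
`α⁻¹(A ∩ B) ≅ A ∩ B ≅ β⁻¹(A ∩ B)`, `π = pushout.desc (α ≫ iA) (β ≫ iB)`; `π⁻¹(iA A) = inl A'` and
`π⁻¹(iB B) = inr B'` give `IsPullback α inl iA π`, `IsPullback β inr iB π`, so `π` is proper
(Zariski-local on the target) and an isomorphism over `W ∩ A` and `W ∩ B`, hence over `W`;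
density from the two dense pieces. [Stacks 01JA (gluing schemes); folklore] -/
theorem stub_hasResolution_glue2 (X A B A' B' : Scheme.{0}) (iA : A ⟶ X) [IsOpenImmersion iA]
    (iB : B ⟶ X) [IsOpenImmersion iB] (hcover : iA.opensRange ⊔ iB.opensRange = ⊤)
    (W : X.Opens) (hW : iA.opensRange ⊓ iB.opensRange ≤ W)
    (α : A' ⟶ A) [IsProper α] (hA' : Scheme.IsRegular A') (hα : IsIso (α ∣_ (iA ⁻¹ᵁ W)))
    (hαd : Dense ((α ⁻¹ᵁ (iA ⁻¹ᵁ W) : A'.Opens) : Set A'))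
    (β : B' ⟶ B) [IsProper β] (hB' : Scheme.IsRegular B') (hβ : IsIso (β ∣_ (iB ⁻¹ᵁ W)))
    (hβd : Dense ((β ⁻¹ᵁ (iB ⁻¹ᵁ W) : B'.Opens) : Set B')) :
    ∃ (X' : Scheme.{0}) (π : X' ⟶ X), IsProper π ∧ Scheme.IsRegular X' ∧ IsIso (π ∣_ W) ∧
      Dense ((π ⁻¹ᵁ W : X'.Opens) : Set X') := by
  -- the overlap `O = iA(A) ∩ iB(B) ⊆ W`, an open subscheme of `X`
  set O : X.Opens := iA.opensRange ⊓ iB.opensRange with hO_def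
  have hOr : O.ι.opensRange = O := Scheme.Opens.opensRange_ι O
  -- the two legs `b : O → A'`, `a : O → B'`
  obtain ⟨b, hbo, hb, hbr⟩ := exists_openGlue_leg α iA W hα O.ι
    (by rw [hOr]; exact inf_le_left) (by rw [hOr]; exact hW)
  obtain ⟨a, hao, ha, har⟩ := exists_openGlue_leg β iB W hβ O.ι
    (by rw [hOr]; exact inf_le_right) (by rw [hOr]; exact hW)
  haveI := hbo
  haveI := hao
  have hcomm : b ≫ α ≫ iA = a ≫ β ≫ iB := hb.trans ha.symm
  set π : pushout b a ⟶ X := pushout.desc (α ≫ iA) (β ≫ iB) hcomm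
  have hπl : pushout.inl b a ≫ π = α ≫ iA := pushout.inl_desc _ _ _
  have hπr : pushout.inr b a ≫ π = β ≫ iB := pushout.inr_desc _ _ _
  haveI := openGlue_isOpenImmersion_inl b a
  haveI := openGlue_isOpenImmersion_inr b a
  have hπl' : ∀ u : A', π (pushout.inl b a u) = iA (α u) := fun u => by
    rw [← Scheme.Hom.comp_apply, hπl, Scheme.Hom.comp_apply]
  have hπr' : ∀ y : B', π (pushout.inr b a y) = iB (β y) := fun y => by
    rw [← Scheme.Hom.comp_apply, hπr, Scheme.Hom.comp_apply]
  -- `π⁻¹(iA(A)) = inl(A')`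
  have hA : π ⁻¹ᵁ iA.opensRange = (pushout.inl b a).opensRange := by
    refine Opens.ext ?_
    rw [Scheme.Hom.coe_opensRange]
    refine openGlue_preimage_eq_range_inl b a π _ (fun u => ?_) (fun y hy => ?_)
    · rw [hπl']
      exact ⟨α u, rfl⟩
    · rw [hπr'] at hy
      exact har y (by rw [hOr]; exact Opens.mem_inf.mpr ⟨hy, ⟨β y, rfl⟩⟩)
  -- `π⁻¹(iB(B)) = inr(B')`
  have hB : π ⁻¹ᵁ iB.opensRange = (pushout.inr b a).opensRange := by
    refine Opens.ext ?_
    rw [Scheme.Hom.coe_opensRange]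
    refine openGlue_preimage_eq_range_inr b a π _ (fun y => ?_) (fun u hu => ?_)
    · rw [hπr']
      exact ⟨β y, rfl⟩
    · rw [hπl'] at hu
      exact hbr u (by rw [hOr]; exact Opens.mem_inf.mpr ⟨⟨α u, rfl⟩, hu⟩)
  -- the two cartesian squares
  have sqA : IsPullback α (pushout.inl b a) iA π := IsOpenImmersion.isPullback _ _ _ _ hπl hA
  have sqB : IsPullback β (pushout.inr b a) iB π := IsOpenImmersion.isPullback _ _ _ _ hπr hB
  refine ⟨pushout b a, π, ?_, openGlue_isRegular b a hA' hB', ?_, ?_⟩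
  · -- properness is Zariski-local on the target
    have hpA : IsProper (π ∣_ iA.opensRange) :=
      morphismRestrict_opensRange_of_isPullback π _ α iA sqA @IsProper inferInstance
    have hpB : IsProper (π ∣_ iB.opensRange) :=
      morphismRestrict_opensRange_of_isPullback π _ β iB sqB @IsProper inferInstance
    refine IsZariskiLocalAtTarget.of_iSup_eq_top (P := @IsProper)
      (fun c : Bool => cond c iA.opensRange iB.opensRange)
      ((sup_eq_iSup _ _).symm.trans hcover) ?_
    rintro (_ | _)
    · exact hpB
    · exact hpA
  · -- `π` is an isomorphism over `W = (iA(A) ∩ W) ∪ (iB(B) ∩ W)`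
    have h := isIso_morphismRestrict_sup π
      (isIso_morphismRestrict_inf_of_isPullback α _ iA π sqA W hα)
      (isIso_morphismRestrict_inf_of_isPullback β _ iB π sqB W hβ)
    have e : iA.opensRange ⊓ W ⊔ iB.opensRange ⊓ W = W := by
      rw [← inf_sup_right, hcover, top_inf_eq]
    rw [e] at h
    exact h
  · -- density of `π⁻¹ W`: its traces on `A'` and `B'` are `α⁻¹ iA⁻¹ W` and `β⁻¹ iB⁻¹ W`
    refine openGlue_dense b a _ ?_ ?_
    · have e : (pushout.inl b a) ⁻¹' ((π ⁻¹ᵁ W : (pushout b a).Opens) : Set ↥(pushout b a)) =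
          ((α ⁻¹ᵁ (iA ⁻¹ᵁ W) : A'.Opens) : Set A') := by
        ext u
        show π (pushout.inl b a u) ∈ W ↔ iA (α u) ∈ W
        rw [hπl']
      rw [e]
      exact hαd
    · have e : (pushout.inr b a) ⁻¹' ((π ⁻¹ᵁ W : (pushout b a).Opens) : Set ↥(pushout b a)) =
          ((β ⁻¹ᵁ (iB ⁻¹ᵁ W) : B'.Opens) : Set B') := by
        ext y
        show π (pushout.inr b a y) ∈ W ↔ iB (β y) ∈ W
        rw [hπr']
      rw [e]
      exact hβd

end Summit.ResolutionOfSingularities.ResolutionOfSingularities.Theorems.FRationalResolution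

end
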